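import Summits.ResolutionOfSingularities.ResolutionOfSingularities.Theorems.EquisingularLiftEquisingularLiftNatTowerRoundFourDefs
import Summits.ResolutionOfSingularities.ResolutionOfSingularities.Theorems.EquisingularLiftEquisingularLiftNatDirZeroDefs
import Literature.AlgebraicGeometry.HodgeTheory.NormalSheafAffineSections
import HarnessLib

/-!
# [OURS · L1 W4.5(b) · EL♮(3) · WIDTH TABLE D8 «NODAL HOSTED ROUND (HR-KEEP-N)», support debt S-D8-LIFT, part 2] THE NODAL LIFT RESIDUE (T-k)-N
# `NodalEmbeddedCurveLiftAt` / `NodalEmbeddedCurveLift O k θ P q` / `NodalEmbeddedCurveLiftFact` — F-88's (T-k) with «`Z̃` regular» ↦ (N1) + (N4)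

res-L1-w45b-stub-4 g14 (desk R69 (iii): S-D8-LIFT booked as stub-4's support debt; plan of record `L/res-L1-w45b-stub-4/g13/S-D8-LIFT-PLAN.md`,
step (2)).  OURS; planning vocabulary of the crux chain, NOT a statement of any manuscript ([Hironaka2017] is a candidate under adjudication,
D-0012/D-0089, nothing of it is asserted here); AI-written, weaker than expert review.  Definitions + pure-logic lemmas only (no `sorry`, standard
axioms).  `--supports stmt-ResolutionOfSingularities-20148 --as helper`.

WHY.  ✓ `TCPlus.hround_keep k hF` (…NatHostedRoundKeep) discharges the K5⁷ engine's HROUND-KEEP supplier from F-88 `hF : EmbeddedCurveLiftFact`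
(…NatTowerRoundFourDefs l.188), whose `EmbeddedCurveLiftAt` carries the antecedent «`Z̃` regular» — unusable for the NODAL centre traces of the D8
width (K5⁸ `target_elnat_of_letteredPrefixResolution8`, supplier binder `NodalHostedRoundFact` ✓ p693330).  By the bytes of `hround_keep`'s proof,
«`Z̃` regular» is read in exactly two places: the (CL) bridge — removed by ✓ `TCPlus.crossedLetter_clausesN` (…NatCrossedLetterNodal, p694196) — and
the lift (T-k) itself.  This file types the NODAL lift residue that replaces F-88 there, so that part 3 can prove
`nodalHostedRoundFact_of_nodalEmbeddedCurveLiftFact : NodalEmbeddedCurveLiftFact → NodalHostedRoundFact` by `hround_keep`'s composition.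

WHAT.
* `NodalEmbeddedCurveLiftAt O k θ X σ q 𝓔` — F-88's `EmbeddedCurveLiftAt` VERBATIM with its binder
  `(∀ x : redSub G Z hZ, IsRegularLocalRing ((redSub G Z hZ).presheaf.stalk x)) →` REPLACED by (N1) «the non-regular locus of `Z̃` is finite» and the
  binder (N4) «a global section `ψ ∈ Γ(Z̃, 𝒩_{Z̃/Ẽ})` that is a unit at every non-regular closed point of `Z̃`» INSERTED right after `DirStepUnobs G E hE Z hZ →`
  — both with the bytes of `NodalHostedRoundFact` (✓ p693330 ll.79–91) under `F₁ ↦ G`, `closure E₁ ↦ E`, `isClosed_closure ↦ hE`; conclusion UNCHANGED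
  (a centre `C ⊇ 𝓔`, regular, `O`-flat, exact reduced trace `C·𝒪_G = 𝓘⟨Z⟩`, quasi-regular 2-frames where `V(C)` has codimension 2).
* `NodalEmbeddedCurveLift O k θ P q`, `NodalEmbeddedCurveLiftFact` — the same closures as F-88's (`∀ X σ 𝓔`; `∀ k = k̄, O` complete DVR, `θ : O ↠ k`, `P, q`).
* PURE LOGIC: `embeddedCurveLiftAt_of_nodal`, `embeddedCurveLift_of_nodal`, ★ `embeddedCurveLiftFact_of_nodal : NodalEmbeddedCurveLiftFact →
  EmbeddedCurveLiftFact` — the nodal residue IMPLIES F-88's (at a regular `Z̃` the set in (N1) is empty and (N4) holds with `ψ := 0`, vacuously), so a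
  rung taking `NodalEmbeddedCurveLiftFact` needs no separate `EmbeddedCurveLiftFact`.
Informal route to its discharge (LATER; not claimed here): embedded deformations of the l.c.i. curve `Z̃ ⊆ Ẽ` are unobstructed when `H¹(𝒩) = 0`
(Hartshorne 2010, Thm. 6.2/22.3 — index only), so EVERY first-order direction `ψ ∈ H⁰(𝒩)` extends to a formal lift, algebraic over the complete `O` by
Grothendieck existence for the proper `V(𝓔)`; choosing the (N4) direction makes the total space regular at the finitely many singular points of `Z̃`
(local equation `f + ϖ·g` with `f ∈ 𝔪²`, `g` a unit — mirror `L/res-L1-w45b-stub-4/g13/NodalLiftRegular.lean` 67b031e4304d52dc), and it is regular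
elsewhere by `O`-flatness with regular special fibre.  Consumed ONLY as a hypothesis.
References (index only, no claim typed from them here): R. Hartshorne, *Deformation Theory*, GTM 257 (2010), Thm. 6.2, Thm. 22.3; J. Kollár, *Rational
Curves on Algebraic Varieties* (1996), Thm. I.2.10; A. Grothendieck, FGA 221; EGA III₁ 5.4.5 (existence).
-/

set_option linter.dupNamespace false

noncomputable section

open CategoryTheory AlgebraicGeometry TopologicalSpace
open Literature.AlgebraicGeometry.Resolution
open AlgebraicGeometry.Scheme.IdealSheafData

namespace Summit.ResolutionOfSingularities.ResolutionOfSingularities.Cruxes.EquisingularLiftNat.Sections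

/-! ### The nodal hypothesis-residue (T-k)-N -/

/-- **`NodalEmbeddedCurveLiftAt O k θ X σ q 𝓔` — the NODAL residue (T-k)-N at ONE exceptional surface.**  F-88's `EmbeddedCurveLiftAt` (for the stage
`σ : X ⟶ P` over `q : P ⟶ Spec O`, `X` regular, locally Noetherian, integral; `V(𝓔) ⊆ X` regular, flat and proper over `Spec O`; a model square `(j, t)`
over `θ : O → k`; `E ⊆ G` closed with exact reduced trace `𝓔·𝒪_G = 𝓘⟨E⟩`; `Z ⊆ E` closed) with the binder «`Z̃` regular» REPLACED by (N1) «the set of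
non-regular points of `Z̃` is finite» and, after `DirStepUnobs G E hE Z hZ` (`H¹(Z̃, 𝒩_{Z̃/Ẽ}) = 0`), the NEW binder (N4) «some global section `ψ` of the
normal sheaf `𝒩_{Z̃/Ẽ}` takes a unit value at every non-regular closed point of `Z̃`» (bytes of `NodalHostedRoundFact`, ✓ p693330, with `F₁ ↦ G`,
`closure E₁ ↦ E`); `Ẽ` regular along `Z̃` as before; conclusion UNCHANGED: a centre `C` with `𝓔 ≤ C`, regular, flat over `Spec O`, exact reduced trace
`C·𝒪_G = 𝓘⟨Z⟩`, stalk ideals generated by quasi-regular pairs where `V(C)` has codimension 2.  [OURS · L1 W4.5b · residue (T-k)-N] (Hartshorne 2010,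
Thm. 6.2/22.3; Kollár 1996, Thm. I.2.10 — index only); consumed ONLY as a hypothesis; NOT a statement of the manuscript. -/
def NodalEmbeddedCurveLiftAt (O : Type) [CommRing O] (k : Type) [Field k] (θ : O →+* k) {P : Scheme.{0}}
    (X : Scheme.{0}) (σ : X ⟶ P) (q : P ⟶ Spec (.of O)) (𝓔 : X.IdealSheafData) : Prop :=
  IsIntegral X → IsLocallyNoetherian X → Scheme.IsRegular X →
  Scheme.IsRegular 𝓔.subscheme → Flat (𝓔.subschemeι ≫ σ ≫ q) → IsProper (𝓔.subschemeι ≫ σ ≫ q) →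
  ∀ (G : Scheme.{0}) (j : G ⟶ X) (t : G ⟶ Spec (.of k)),
    IsPullback j t (σ ≫ q) (Spec.map (CommRingCat.ofHom θ)) →
    ∀ (E : Set G) (hE : IsClosed E), 𝓔.comap j = vanishingIdeal (⟨E, hE⟩ : Closeds G) →
    ∀ (Z : Set G) (hZ : IsClosed Z), Z ⊆ E →
      Set.Finite {x : ↥(redSub G Z hZ) | ¬ IsRegularLocalRing ((redSub G Z hZ).presheaf.stalk x)} →
      (∀ (i : redSub G Z hZ ⟶ redSub G E hE), i ≫ redSubι G E hE = redSubι G Z hZ →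
        ∀ x : redSub G Z hZ, IsRegularLocalRing ((redSub G E hE).presheaf.stalk (i x))) →
      DirStepUnobs G E hE Z hZ →
      (∀ (i : redSub G Z hZ ⟶ redSub G E hE), i ≫ redSubι G E hE = redSubι G Z hZ →
        ∃ ψ : Γ(Literature.AlgebraicGeometry.HodgeTheory.normalSheaf i, ⊤),
          ∀ z : ↥(redSub G Z hZ), IsClosed ({z} : Set ↥(redSub G Z hZ)) → ¬ IsRegularLocalRing ((redSub G Z hZ).presheaf.stalk z) →
            ∃ (U : (redSub G E hE).affineOpens) (hz : z ∈ i ⁻¹ᵁ (U : (redSub G E hE).Opens))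
              (m : Γ(Literature.AlgebraicGeometry.Deformation.idealModule i, (U : (redSub G E hE).Opens))),
              IsUnit ((redSub G Z hZ).presheaf.germ (i ⁻¹ᵁ (U : (redSub G E hE).Opens)) z hz
                (Literature.AlgebraicGeometry.HodgeTheory.normalSectionsVal i U
                  (Literature.AlgebraicGeometry.HodgeTheory.normalSheafSectionsEquiv i _
                    ((Literature.AlgebraicGeometry.HodgeTheory.normalSheaf i).presheaf.map (homOfLE le_top).op ψ)) m))) →
      ∃ C : X.IdealSheafData, 𝓔 ≤ C ∧ Scheme.IsRegular C.subscheme ∧ Flat (C.subschemeι ≫ σ ≫ q) ∧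
        C.comap j = vanishingIdeal (⟨Z, hZ⟩ : Closeds G) ∧
        ∀ x ∈ C.support, ringKrullDim (X.presheaf.stalk x ⧸ stalkIdeal C x) + 2 = ringKrullDim (X.presheaf.stalk x) →
          ∃ c : Fin 2 → X.presheaf.stalk x, Ideal.span (Set.range c) = stalkIdeal C x ∧ IsQuasiRegular c

/-- **`NodalEmbeddedCurveLift O k θ P q` — the nodal residue (T-k)-N for the WHOLE tower over `q : P ⟶ Spec O`**: `NodalEmbeddedCurveLiftAt` at every
stage and every exceptional surface (F-88's `EmbeddedCurveLift`, nodal). [OURS · L1 W4.5b · residue (T-k)-N]; hypothesis-only; NOT a statement of the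
manuscript. -/
def NodalEmbeddedCurveLift (O : Type) [CommRing O] (k : Type) [Field k] (θ : O →+* k) (P : Scheme.{0}) (q : P ⟶ Spec (.of O)) : Prop :=
  ∀ (X : Scheme.{0}) (σ : X ⟶ P) (𝓔 : X.IdealSheafData), NodalEmbeddedCurveLiftAt O k θ X σ q 𝓔

/-- **`NodalEmbeddedCurveLiftFact` — (T-k)-N closed over every base the chain may choose**: for every algebraically closed field `k`, every adically
complete discrete valuation ring `O` with a surjection `θ : O → k`, and every `P` over `Spec O`, `NodalEmbeddedCurveLift O k θ P q` (F-88's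
`EmbeddedCurveLiftFact`, nodal).  The tree-vocabulary form of «reduced curves with finitely many singular points and `H¹(𝒩) = 0` on the special fibre
of a flat proper `O`-scheme lift, with regular total space when a first-order direction is a unit at the singular points» (Hartshorne 2010, Thm.
6.2/22.3; Kollár 1996, Thm. I.2.10 — index only).  [OURS · L1 W4.5b · residue (T-k)-N]; hypothesis-only; NOT a statement of the manuscript. -/
def NodalEmbeddedCurveLiftFact : Prop :=
  ∀ (k : Type) [Field k] [IsAlgClosed k] (O : Type) [CommRing O] [IsDomain O] [IsDiscreteValuationRing O]
    [IsAdicComplete (IsLocalRing.maximalIdeal O) O] (θ : O →+* k), Function.Surjective θ →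
    ∀ (P : Scheme.{0}) (q : P ⟶ Spec (.of O)), NodalEmbeddedCurveLift O k θ P q

/-! ### Pure logic: the nodal residue implies F-88's -/

/-- **(T-k)-N ⟹ (T-k) at one exceptional surface**: at a REGULAR `Z̃` the set in (N1) is empty and (N4) holds with `ψ := 0` (its condition quantifies
over non-regular closed points, of which there are none), so `NodalEmbeddedCurveLiftAt` specialises to F-88's `EmbeddedCurveLiftAt`. [OURS · pure logic] -/
theorem embeddedCurveLiftAt_of_nodal (O : Type) [CommRing O] (k : Type) [Field k] (θ : O →+* k) {P : Scheme.{0}}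
    (X : Scheme.{0}) (σ : X ⟶ P) (q : P ⟶ Spec (.of O)) (𝓔 : X.IdealSheafData) (h : NodalEmbeddedCurveLiftAt O k θ X σ q 𝓔) :
    EmbeddedCurveLiftAt O k θ X σ q 𝓔 := by
  intro hXi hXn hXr hEr hEfl hEpr G j t hsq E hE hEtr Z hZ hZE hZreg hEreg hunobs
  refine h hXi hXn hXr hEr hEfl hEpr G j t hsq E hE hEtr Z hZ hZE ?_ hEreg hunobs ?_
  · exact Set.finite_empty.subset fun x hx => (hx (hZreg x)).elim
  · intro i _
    exact ⟨0, fun z _ hz => (hz (hZreg z)).elim⟩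

/-- **(T-k)-N ⟹ (T-k) for the whole tower.** [OURS · pure logic] -/
theorem embeddedCurveLift_of_nodal (O : Type) [CommRing O] (k : Type) [Field k] (θ : O →+* k) (P : Scheme.{0}) (q : P ⟶ Spec (.of O))
    (h : NodalEmbeddedCurveLift O k θ P q) : EmbeddedCurveLift O k θ P q :=
  fun X σ 𝓔 => embeddedCurveLiftAt_of_nodal O k θ X σ q 𝓔 (h X σ 𝓔)

/-- ★ **`NodalEmbeddedCurveLiftFact → EmbeddedCurveLiftFact`**: the nodal residue (T-k)-N implies F-88's (T-k), so a rung that takes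
`NodalEmbeddedCurveLiftFact` by name needs no separate `EmbeddedCurveLiftFact`. [OURS · pure logic] -/
theorem embeddedCurveLiftFact_of_nodal (h : NodalEmbeddedCurveLiftFact) : EmbeddedCurveLiftFact :=
  fun k _ _ O _ _ _ _ θ hθ P q => embeddedCurveLift_of_nodal O k θ P q (h k O θ hθ P q)

end Summit.ResolutionOfSingularities.ResolutionOfSingularities.Cruxes.EquisingularLiftNat.Sections

end
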